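import Literature.AlgebraicGeometry.Frobenioids.ArchimedeanRCConnected
import Literature.AlgebraicGeometry.Frobenioids.Thm36SubRlfCompletion
import Literature.AlgebraicGeometry.Frobenioids.Thm36SubRlfFrobenioid
import Literature.AlgebraicGeometry.Frobenioids.PerfectionPreFrobenioid
import Literature.AlgebraicGeometry.Frobenioids.ModelFrobenioidPullbacks
import HarnessLib

/-!
# Frobenioids II, Example 3.3 (iv) for `Λ ∈ {ℚ, ℝ}`: `C^pf` and `C^rlf` are RC-connected and totally
# epimorphic — PROOF at THE constructed completions

Mochizuki, *The geometry of Frobenioids II: poly-Frobenioids*, Kyushu J. Math. **62** (2008)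
401–460, §3, Example 3.3 (iv), kurims text `paper:url-4322d76898e0` p. 29 ll. 22–23
[cite: MochizukiFrdII2008, Ex 3.3 (iv) p.29]: "If `D` is RC-connected, then one verifies immediately
that `C^Λ`, `A`, `N`, `R` are RC-connected [hence, in particular, connected] and totally epimorphic."
Here `C^ℤ := C`, `C^ℚ := C^pf`, `C^ℝ := C^rlf` (Ex. 3.3 (ii), p. 28 ll. 44–46).

PROOF-ONLY file (abc-iut cell, layer L1, node `FrdII:Ex3.3(iv)`, seat abc-iut-L1-t6 = typer of record of
Example 3.3).  The typed statements `ArchFrd.Ex33iv_rcConnected` / `ArchFrd.Ex33iv_totallyEpimorphic`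
(`ArchimedeanFrobenioidStatements.lean`) cover `C = C^ℤ`, `A`, `N`, `R` and are PROVED
(`Ex33iv_rcConnected_holds`, `ArchimedeanRCConnected.lean`; `Ex33iv_totallyEpimorphic_holds`); their
docstrings record that the `Λ ∈ {ℚ, ℝ}` members of the printed clause were left out because `C^pf`,
`C^rlf` were interface data (`LambdaCompletion`) at typing time.  Both completions have since been
CONSTRUCTED in the tree — THE perfection `Thm36Sub.pfCat π hF` / `pfCompletion π hF` ([FrdI] Def. 3.1
(iii), `PreFrobenioid.Perfection`) and THE realification `Thm36Sub.rlfCat π` / `rlfCompletion π` ([FrdI]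
Prop. 5.3, the model Frobenioid of `(Φ^rlf, ℝ · Φ^birat)`) — so the residual clause is closed here:

* `PreFrobenioid.Perfection.isRCConnected` — for ANY Frobenioid `C → F_Φ` over a base `D → D₀^arch`:
  if `C` is RC-connected then so is `C^pf` (every `(A, n)` maps to `ι(A) = (A, 1)` over its own base point,
  and `ι : C → C^pf` carries zigzags of `C`, `C[ℝ]`, `C[ℂ]`);
* `ModelFrobenioid.isRCConnected` — for ANY model Frobenioid ([FrdI] Thm. 5.2 (i)) over `D → D₀^arch`:
  if `D` is RC-connected then so is the model Frobenioid (every `(A_D, α)` is linked to the zero section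
  `(A_D, 0)` by a span over `A_D`, and the zero section carries zigzags of `D`, `D[ℝ]`, `D[ℂ]`);
* `ArchFrd.Thm36Sub.pf_isRCConnected` / `rlf_isRCConnected` / `pf_isTotallyEpimorphic` /
  `rlf_isTotallyEpimorphic` — the instances at THE completions of the archimedean Frobenioid;
* `ArchFrd.Ex33iv_rcConnected_lambda_holds` / `ArchFrd.Ex33iv_totallyEpimorphic_lambda_holds` — the
  printed clause for `C^Λ`, EVERY monoid type `Λ`, at the family
  `archFrobenioid π (pfCompletion π hF) (rlfCompletion π) Λ` of `AngularFrobenioidsRelative.lean`.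

The hypothesis `hF : IsFrobenioid (C → F_Φ)` under which `C^pf` is formed is print's "`C` is a Frobenioid"
(Ex. 3.3 (ii); in the tree `ArchFrd.Ex33ii_isFrobenioid_holds π hDc hDe`).  Generic zigzag-lifting lemma:
`ArchFrd.part_of_retraction` (cf. `ArchFrd.part_of_std`).  [FrdI]/[FrdII] §3 are classical; nothing here
takes a side on [IUTchIII] Cor. 3.12.  No new definitions.
-/

noncomputable section

namespace Literature.AlgebraicGeometry.Frobenioids

open CategoryTheory Opposite

/-! ### Generic zigzag lifting along a functor with a retraction on objects -/

namespace ArchFrd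

section Retraction

universe v₁ u₁ v₂ u₂

variable {E : Type u₁} [Category.{v₁} E] {B : Type u₂} [Category.{v₂} B]

/-- Zigzags of `B` map to zigzags of the `q`-part of `E` along a functor `ι : B ⥤ E` whose values satisfy `q`.
[cite: MochizukiFrdII2008, Ex 3.3 (iv) p.29] -/
theorem zigzag_part_of_functor (ι : B ⥤ E) (p : ObjectProperty B) (q : ObjectProperty E)
    (hι : ∀ b : B, p b → q (ι.obj b)) {b₁ b₂ : p.FullSubcategory} (h : Zigzag b₁ b₂) :
    Zigzag (⟨ι.obj b₁.obj, hι _ b₁.property⟩ : q.FullSubcategory) ⟨ι.obj b₂.obj, hι _ b₂.property⟩ := by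
  induction h with
  | refl => exact Relation.ReflTransGen.refl
  | tail _ hz ih =>
    refine ih.trans ?_
    rcases hz with ⟨⟨u⟩⟩ | ⟨⟨u⟩⟩
    · exact Zigzag.of_hom (ObjectProperty.homMk (ι.map u.hom))
    · exact Zigzag.of_inv (ObjectProperty.homMk (ι.map u.hom))

/-- **Lifting lemma.** Let `ι : B ⥤ E` be a functor and `r : Ob(E) → Ob(B)` a retraction of it on objects
(`r (ι b) = b`) such that every object `X` of `E` is linked to `ι (r X)` by a span `X ← W → ι (r X)` with
`r W = r X`; let `q = p ∘ r` be an object property of `E` induced from one of `B`.  If the `p`-part of `B` is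
empty or connected, then so is the `q`-part of `E`. [cite: MochizukiFrdII2008, Ex 3.3 (iv) p.29] -/
theorem part_of_retraction (ι : B ⥤ E) (r : E → B) (hr : ∀ b : B, r (ι.obj b) = b)
    (conn : ∀ X : E, ∃ W : E, r W = r X ∧ Nonempty (W ⟶ X) ∧ Nonempty (W ⟶ ι.obj (r X)))
    (p : ObjectProperty B) (q : ObjectProperty E) (hq : ∀ X : E, q X ↔ p (r X))
    (hp : IsEmpty p.FullSubcategory ∨ IsConnected p.FullSubcategory) :
    IsEmpty q.FullSubcategory ∨ IsConnected q.FullSubcategory := by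
  have hι : ∀ b : B, p b → q (ι.obj b) := fun b hb => (hq _).mpr (by rw [hr]; exact hb)
  rcases hp with he | hc
  · exact Or.inl ⟨fun X => he.false ⟨r X.obj, (hq X.obj).mp X.property⟩⟩
  · right
    obtain ⟨b₀⟩ := hc.is_nonempty
    haveI : Nonempty q.FullSubcategory := ⟨⟨ι.obj b₀.obj, hι _ b₀.property⟩⟩
    -- every object of the `q`-part is linked, inside the `q`-part, to `ι` of its retraction point
    have link : ∀ X : q.FullSubcategory,
        Zigzag X ⟨ι.obj (r X.obj), hι _ ((hq X.obj).mp X.property)⟩ := by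
      intro X
      obtain ⟨W, hW, ⟨w₁⟩, ⟨w₂⟩⟩ := conn X.obj
      have hWq : q W := (hq W).mpr (by rw [hW]; exact (hq X.obj).mp X.property)
      exact (Zigzag.of_inv (ObjectProperty.homMk w₁ : (⟨W, hWq⟩ : q.FullSubcategory) ⟶ X)).trans
        (Zigzag.of_hom (ObjectProperty.homMk w₂ : (⟨W, hWq⟩ : q.FullSubcategory) ⟶ _))
    refine zigzag_isConnected fun X Y => ?_
    have hz := zigzag_part_of_functor ι p q hι
      (isPreconnected_zigzag (⟨r X.obj, (hq X.obj).mp X.property⟩ : p.FullSubcategory)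
        ⟨r Y.obj, (hq Y.obj).mp Y.property⟩)
    exact (link X).trans (hz.trans (link Y).symm)

/-- **Lifting lemma, whole category.** With `ι`, `r` and spans as in `part_of_retraction`: if `B` is
connected then so is `E`. [cite: MochizukiFrdII2008, Ex 3.3 (iv) p.29] -/
theorem isConnected_of_retraction (ι : B ⥤ E) (r : E → B)
    (conn : ∀ X : E, ∃ W : E, r W = r X ∧ Nonempty (W ⟶ X) ∧ Nonempty (W ⟶ ι.obj (r X)))
    (hB : IsConnected B) : IsConnected E := by
  haveI := hB.is_nonempty
  haveI : Nonempty E := ⟨ι.obj (Classical.arbitrary B)⟩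
  refine zigzag_isConnected fun X Y => ?_
  obtain ⟨W, -, ⟨w₁⟩, ⟨w₂⟩⟩ := conn X
  obtain ⟨W', -, ⟨w₁'⟩, ⟨w₂'⟩⟩ := conn Y
  exact ((Zigzag.of_inv w₁).trans (Zigzag.of_hom w₂)).trans
    ((zigzag_obj_of_zigzag ι (isPreconnected_zigzag (r X) (r Y))).trans
      ((Zigzag.of_inv w₂').trans (Zigzag.of_hom w₁')))

/-- **RC-connectedness transfer** (FrdII Def. 3.1 (v)): with `ι : B ⥤ E`, `r`, spans as above and base
functors `G : E → D₀^arch`, `P : B → D₀^arch` with `G = P ∘ r` on objects, RC-connectedness of `B` implies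
RC-connectedness of `E`. [cite: MochizukiFrdII2008, Ex 3.3 (iv) p.29] -/
theorem isRCConnected_of_retraction (ι : B ⥤ E) (r : E → B) (hr : ∀ b : B, r (ι.obj b) = b)
    (conn : ∀ X : E, ∃ W : E, r W = r X ∧ Nonempty (W ⟶ X) ∧ Nonempty (W ⟶ ι.obj (r X)))
    (G : E ⥤ ArchBase) (P : B ⥤ ArchBase) (hGP : ∀ X : E, G.obj X = P.obj (r X))
    (h : RC.IsRCConnected P) : RC.IsRCConnected G where
  isConnected := isConnected_of_retraction ι r conn h.isConnected
  real := part_of_retraction ι r hr conn (RC.realObjects P) (RC.realObjects G)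
    (fun X => by change ArchBase.IsReal _ ↔ ArchBase.IsReal _; rw [hGP]) h.real
  complex := part_of_retraction ι r hr conn (RC.complexObjects P) (RC.complexObjects G)
    (fun X => by change ArchBase.IsComplex _ ↔ ArchBase.IsComplex _; rw [hGP]) h.complex

end Retraction

end ArchFrd

/-! ### The perfection of a Frobenioid over an RC-connected Frobenioid is RC-connected -/

namespace PreFrobenioid

namespace Perfection

universe w v v' u u' v₀ u₀

variable {D : Type u} [Category.{v} D] {Φ : Dᵒᵖ ⥤ CommMonCat.{w}}
  {C : Type u'} [Category.{v'} C] {F : C ⥤ ElemFrobenioid Φ} {hF : IsFrobenioid F}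

variable (hF) in
/-- **`C^pf` is RC-connected when `C` is** (FrdII Ex. 3.3 (iv) for `Λ = ℚ`, in general): over any base
functor `P : D → D₀^arch`, every object `(A, n)` of `C^pf` maps to `ι(A) = (A, 1)` over its own base point
(`nonempty_hom_toPf_obj`), and `ι : C → C^pf` ([FrdI] Def. 3.1 (iii)) carries the zigzags of `C`, `C[ℝ]`,
`C[ℂ]`. [cite: MochizukiFrdII2008, Ex 3.3 (iv) p.29] -/
theorem isRCConnected (P : D ⥤ ArchBase) (h : RC.IsRCConnected (baseFunctor F ⋙ P)) :
    RC.IsRCConnected (baseFunctor (ops hF).toFunctor ⋙ P) :=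
  ArchFrd.isRCConnected_of_retraction (toPf hF) (fun X => X.obj) (fun _ => rfl)
    (fun X => ⟨X, rfl, ⟨𝟙 X⟩, nonempty_hom_toPf_obj X⟩) _ _ (fun _ => rfl) h

end Perfection

end PreFrobenioid

/-! ### A model Frobenioid over an RC-connected base is RC-connected -/

namespace ModelFrobenioid

universe w v u

variable {D : Type u} [Category.{v} D] {Φ B : Dᵒᵖ ⥤ CommMonCat.{w}} {DivB : B ⟶ monoidGp Φ}

/-- Every object `(A_D, α)` of a model Frobenioid is linked to the zero section `(A_D, 0)` by a span over
`A_D`: writing `α = a − b` with `a, b ∈ Φ(A_D)`, the object `(A_D, −b)` maps to both by the base-identity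
linear morphisms of zero divisor `a`, resp. `b` ([FrdI] Thm. 5.2 (i)). [cite: MochizukiFrdI2008, Thm. 5.2(ii) p.101] -/
theorem exists_span_zeroSection (X : ModelFrobenioid Φ B DivB) :
    ∃ W : ModelFrobenioid Φ B DivB, W.base = X.base ∧ Nonempty (W ⟶ X) ∧
      Nonempty (W ⟶ (zeroSection Φ B DivB).obj X.base) := by
  obtain ⟨a, b, hab⟩ := gp_exists_mul_of_eq_of X.cls
  let W : ModelFrobenioid Φ B DivB := ⟨X.base, (Algebra.GrothendieckGroup.of b)⁻¹⟩
  have w₁ : W ⟶ X := mkHom W X 1 (𝟙 _) a 1 (by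
    show (Algebra.GrothendieckGroup.of b)⁻¹ ^ ((1 : ℕ+) : ℕ) * Algebra.GrothendieckGroup.of a =
      pullGp Φ (𝟙 X.base) X.cls * divB Φ B DivB _ 1
    rw [PNat.one_coe, pow_one, pullGp_id, map_one, mul_one, inv_mul_eq_iff_eq_mul, ← hab, mul_comm])
  have w₂ : W ⟶ (zeroSection Φ B DivB).obj X.base := mkHom W _ 1 (𝟙 _) b 1 (by
    show (Algebra.GrothendieckGroup.of b)⁻¹ ^ ((1 : ℕ+) : ℕ) * Algebra.GrothendieckGroup.of b =
      pullGp Φ (𝟙 X.base) 1 * divB Φ B DivB _ 1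
    rw [PNat.one_coe, pow_one, inv_mul_cancel, pullGp_id, map_one, mul_one])
  exact ⟨W, rfl, ⟨w₁⟩, ⟨w₂⟩⟩

/-- **A model Frobenioid over an RC-connected base is RC-connected** (FrdII Ex. 3.3 (iv) for `Λ = ℝ`, in
general): over any base functor `P : D → D₀^arch`, the zero section `A_D ↦ (A_D, 0)` carries the zigzags
of `D`, `D[ℝ]`, `D[ℂ]`, and every object is linked to it by a span over its own base point
(`exists_span_zeroSection`). [cite: MochizukiFrdII2008, Ex 3.3 (iv) p.29] -/
theorem isRCConnected (P : D ⥤ ArchBase) (h : RC.IsRCConnected P) :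
    RC.IsRCConnected (PreFrobenioid.baseFunctor (toElem Φ B DivB) ⋙ P) :=
  ArchFrd.isRCConnected_of_retraction (zeroSection Φ B DivB) (fun X => X.base) (fun _ => rfl)
    exists_span_zeroSection _ _ (fun _ => rfl) h

end ModelFrobenioid

/-! ### Example 3.3 (iv) at THE completions `C^ℚ := C^pf`, `C^ℝ := C^rlf` of the archimedean Frobenioid -/

namespace ArchFrd

open Literature.AnabelianGeometry.EtaleTheta

universe v u

variable {D : Type u} [Category.{v} D] (π : D ⥤ D0)

namespace Thm36Sub

/-- **Ex. 3.3 (iv), `Λ = ℚ`**: THE perfection `C^pf` of the archimedean Frobenioid is RC-connected when `D`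
is. [cite: MochizukiFrdII2008, Ex 3.3 (iv) p.29] -/
theorem pf_isRCConnected (hF : PreFrobenioid.IsFrobenioid (C.toElem π))
    (h : RC.IsRCConnected (π ⋙ D0.toArchBase)) :
    RC.IsRCConnected (PreFrobenioid.baseFunctor (pfStr π hF) ⋙ π ⋙ D0.toArchBase) :=
  PreFrobenioid.Perfection.isRCConnected hF (π ⋙ D0.toArchBase) (C.isRCConnected π h)

/-- **Ex. 3.3 (iv), `Λ = ℝ`**: THE realification `C^rlf` of the archimedean Frobenioid is RC-connected
when `D` is. [cite: MochizukiFrdII2008, Ex 3.3 (iv) p.29] -/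
theorem rlf_isRCConnected (h : RC.IsRCConnected (π ⋙ D0.toArchBase)) :
    RC.IsRCConnected (PreFrobenioid.baseFunctor (rlfStr π) ⋙ π ⋙ D0.toArchBase) :=
  ModelFrobenioid.isRCConnected (π ⋙ D0.toArchBase) h

/-- **Ex. 3.3 (iv), `Λ = ℚ`**: THE perfection `C^pf` is totally epimorphic ([FrdI] Prop. 3.2 (iii) for the
perfection, `PreFrobenioid.Perfection.isTotallyEpimorphic_perfection`). [cite: MochizukiFrdII2008, Ex 3.3 (iv) p.29] -/
theorem pf_isTotallyEpimorphic (hF : PreFrobenioid.IsFrobenioid (C.toElem π)) :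
    IsTotallyEpimorphic (pfCat π hF) :=
  PreFrobenioid.Perfection.isTotallyEpimorphic_perfection hF

/-- **Ex. 3.3 (iv), `Λ = ℝ`**: THE realification `C^rlf` is totally epimorphic when `D` is (the model
Frobenioid of `(Φ^rlf, ℝ · Φ^birat)`, [FrdI] Thm. 5.2 (ii): `ModelFrobenioid.isTotallyEpimorphic` at the
realified archimedean data). [cite: MochizukiFrdII2008, Ex 3.3 (iv) p.29] -/
theorem rlf_isTotallyEpimorphic (hDe : IsTotallyEpimorphic D) : IsTotallyEpimorphic (rlfCat π) :=
  ModelFrobenioid.isTotallyEpimorphic (isMonoidOn_rlfFunctor_Φ π)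
    (fun X => IsPerfFactorial.Rlf.isDivisorial
      ((PreFrobenioid.IsPerfFactorialOn.op (isPerfFactorialOn_Φ π)) (op X)))
    (isMonoidOn_realSpan π) (rlf_objectwise_isGroupLike π) hDe

end Thm36Sub

/-- **Example 3.3 (iv) for `C^Λ`, every monoid type `Λ`** ("If `D` is RC-connected, then … `C^Λ` … [is]
RC-connected"), at the family `C^ℤ := C`, `C^ℚ := C^pf`, `C^ℝ := C^rlf` built from THE completions
(`archFrobenioid π (pfCompletion π hF) (rlfCompletion π)`): the base functor of `C^Λ` to `D₀^arch` is
RC-connected. [cite: MochizukiFrdII2008, Ex 3.3 (iv) p.29] -/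
theorem Ex33iv_rcConnected_lambda_holds (hF : PreFrobenioid.IsFrobenioid (C.toElem π))
    (h : RC.IsRCConnected (π ⋙ D0.toArchBase)) (Λ : MonoidType) :
    RC.IsRCConnected (PreFrobenioid.baseFunctor
      (archFrobenioid π (Thm36Sub.pfCompletion π hF) (Thm36Sub.rlfCompletion π) Λ).str ⋙ π ⋙ D0.toArchBase) := by
  cases Λ with
  | Z => exact C.isRCConnected π h
  | Q => exact Thm36Sub.pf_isRCConnected π hF h
  | R => exact Thm36Sub.rlf_isRCConnected π h

/-- **Example 3.3 (iv) for `C^Λ`, every monoid type `Λ`** ("… and totally epimorphic"), at the same family,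
`D` totally epimorphic being the standing hypothesis of Example 3.3 (i). [cite: MochizukiFrdII2008, Ex 3.3 (iv) p.29] -/
theorem Ex33iv_totallyEpimorphic_lambda_holds (hF : PreFrobenioid.IsFrobenioid (C.toElem π))
    (hDe : IsTotallyEpimorphic D) (Λ : MonoidType) :
    IsTotallyEpimorphic (archFrobenioid π (Thm36Sub.pfCompletion π hF) (Thm36Sub.rlfCompletion π) Λ).cat := by
  cases Λ with
  | Z => exact (isTotallyEpimorphic_all π hDe).1
  | Q => exact Thm36Sub.pf_isTotallyEpimorphic π hF
  | R => exact Thm36Sub.rlf_isTotallyEpimorphic π hDe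

end ArchFrd

end Literature.AlgebraicGeometry.Frobenioids

end
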